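import Summits.CriticalPhenomena.CardyFormulaZ2.Theorems.CardyWhiteToColouredSimilarityUpgradeCruxWeb
import Summits.CriticalPhenomena.CardyFormulaZ2.Theorems.CardyWhiteToColouredSimilarityUpgradeHeartIffCrux
import Summits.CriticalPhenomena.CardyFormulaZ2.Theorems.CardyWickAnisotropyBoxFamilyToCardyTransport

/-!
# The hearts of the two rectilinear lines coincide: H3 (`SimilarityUpgrade`, stmt-4597) versus
# S1 (`ConfInvTransport`, stmt-0794)  — crux stmt-CriticalPhenomena-4597, line `registered`, lead c5

Route `CardyWhiteToColoured`, sub-problem `CardyFormulaZ2`. Two cruxes of the sub-problem have been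
cut along the same dense class of RECTILINEAR conformal rectangles (Jordan boundary inside finitely
many axis-parallel segments):

* the registered heart **H3** (`stub_rectilinearHeart`) of the line `registered` of
  `CardyWhiteToColoured.SimilarityUpgrade` (stmt-4597): *if* the bond-ℤ² crossing probabilities of
  every conformal rectangle converge to a similarity-invariant `Φ`, then a rectilinear `R` and the
  corner-marked box `R'` of equal modulus have `Φ R = Φ R'` (H3 ⟺ the crux,
  `rectilinearHeart_iff_similarityUpgrade`, lead c3);
* the registered heart **S1** (`stub_rectilinearInvariance`) of the line `birth` of the shared crux
  `ConfInvTransport` (stmt-0794; cruxes of CardyUniqueLimit, CardyMonotoneApproach, CardyOrderDuality,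
  CardyHarmonicInvariants, CardyHausdorffMoment): rectilinear `Q, Q'` with uniformizing data of
  equal cross-ratio have `bondDomainCrossingProb Q δ - bondDomainCrossingProb Q' δ → 0` — LIMIT-FREE;
  S1 alone implies `ConfInvTransport` (`confInvTransport_of_rectilinearInvariance`, lead c3 of
  stmt-14215, using the now-proved domain continuity S2 and exact-modulus realisation S3).

This file records, sorry-free and over tree theorems only, that the two hearts are ONE problem:

* `rectilinearHeart_of_rectilinearInvariance` — **S1 ⇒ H3** unconditionally (S1 ⇒ `ConfInvTransport`
  ⇒ `SimilarityUpgrade` ⇔ H3); so H3 is the weaker, `LimitExists`-conditional form of S1;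
* `rectilinearInvariance_of_thesis`, `confInvTransport_of_thesis` — X_U (`CardyUniqueLimitThesis`,
  stmt-0745) gives S1 and `ConfInvTransport` outright (both sides tend to `f η`);
* `thesis_of_confInvTransport_of_limitExists` — `LimitExists → ConfInvTransport → X_U` (the logic of
  the glue item `CardyUniqueLimit.LimitTransportGlue`, stmt-14241);
* `rectilinearInvariance_of_confInvTransport_of_limitExists` — under `LimitExists`, `ConfInvTransport ⇒ S1`;
* `rectilinearInvariance_of_rectilinearHeart` — **modulo DKKMO Cor. 1.3 and `LimitExists`, H3 ⇒ S1**;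
* `hearts_tfae_of_limitExists` — **modulo DKKMO Cor. 1.3, under `LimitExists` the five statements
  `SimilarityUpgrade`, X_U, `ConfInvTransport`, S1, H3 are equivalent** (`List.TFAE`).

Consequence for the planners: staffing H3 and S1 separately duplicates the one open step
("conformal invariance of bond-ℤ² crossing probabilities on rectilinear pairs", Schramm's Problem
2.11 on a subclass); S1 is the canonical (limit-free, stronger) form, H3 adds nothing provable to it.
S1 and H3 are spelled out verbatim as hypotheses/conclusions (they are the registered stub statements
of the two skeletons; no definition or notation is introduced). The named fact
`Literature.Probability.Percolation.dkkmo_crossing_rotation_invariance` (DKKMO Cor. 1.3 at `q = 1`)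
enters only as an explicit hypothesis of the last two theorems.

References: O. Schramm, Proc. ICM 2006, §2.6 Problem 2.11; H. Duminil-Copin, K. K. Kozlowski,
D. Krachun, I. Manolescu, M. Oulamara, arXiv:2012.11672, Cor. 1.3; B. Bollobás, O. Riordan,
*Percolation* (2006), Ch. 7 Conjecture 1; S. Smirnov, C. R. Acad. Sci. 333 (2001), Thm 1.
-/

noncomputable section

namespace Summit.CriticalPhenomena.CardyFormulaZ2.Theorems.SimilarityUpgradeReduction

open Filter Topology Set
open Literature.Probability.RandomPlanarGeometry
open Literature.Probability.Percolation (bondDomainCrossingProb dkkmo_crossing_rotation_invariance)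
open Summit.CriticalPhenomena.CardyFormulaZ2.Theses
open Summit.CriticalPhenomena.CardyFormulaZ2.Theses.CardyUniqueLimit (CardyUniqueLimitThesis
  LimitExists ConfInvTransport)

/-! ### Unconditional implications -/

/-- **S1 ⇒ `ConfInvTransport`** in the namespace of route `CardyUniqueLimit` (the tree theorem
`confInvTransport_of_rectilinearInvariance` concludes the verbatim twin
`CardyMonotoneApproach.ConfInvTransport`; the two route decls have the same definiens). -/
theorem confInvTransport_of_rectilinearInvariance (h₁ : (∀ (Q Q' : Literature.Probability.RandomPlanarGeometry.ConformalRectangle), (∃ S : Finset (ℂ × ℂ), (∀ p ∈ S, p.1.re = p.2.re ∨ p.1.im = p.2.im) ∧ frontier Q.carrier ⊆ ⋃ p ∈ S, segment ℝ p.1 p.2) → (∃ S : Finset (ℂ × ℂ), (∀ p ∈ S, p.1.re = p.2.re ∨ p.1.im = p.2.im) ∧ frontier Q'.carrier ⊆ ⋃ p ∈ S, segment ℝ p.1 p.2) → ∀ (ψ : Literature.Probability.RandomPlanarGeometry.ConformalEquiv UpperHalfPlane.upperHalfPlaneSet Q.carrier) (y : Fin 4 → ℝ) (ψ' : Literature.Probability.RandomPlanarGeometry.ConformalEquiv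 UpperHalfPlane.upperHalfPlaneSet Q'.carrier) (y' : Fin 4 → ℝ), Q.IsUniformizing ψ y → Q'.IsUniformizing ψ' y' → Literature.Probability.RandomPlanarGeometry.crossRatio y = Literature.Probability.RandomPlanarGeometry.crossRatio y' → Filter.Tendsto (fun δ : ℝ ↦ Literature.Probability.Percolation.bondDomainCrossingProb Q δ - Literature.Probability.Percolation.bondDomainCrossingProb Q' δ) (nhdsWithin (0 : ℝ) (Set.Ioi 0)) (nhds 0))) :
    ConfInvTransport :=
  Summit.CriticalPhenomena.CardyFormulaZ2.Cruxes.BoxFamilyToCardy.Birth.confInvTransport_of_rectilinearInvariance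
    h₁

/-- **S1 ⇒ `SimilarityUpgrade`** (stmt-0794's heart implies stmt-4597), unconditionally:
S1 ⇒ `ConfInvTransport` ⇒ `SimilarityUpgrade` (`similarityUpgrade_of_confInvTransport`, lead c3). -/
theorem similarityUpgrade_of_rectilinearInvariance (h₁ : (∀ (Q Q' : Literature.Probability.RandomPlanarGeometry.ConformalRectangle), (∃ S : Finset (ℂ × ℂ), (∀ p ∈ S, p.1.re = p.2.re ∨ p.1.im = p.2.im) ∧ frontier Q.carrier ⊆ ⋃ p ∈ S, segment ℝ p.1 p.2) → (∃ S : Finset (ℂ × ℂ), (∀ p ∈ S, p.1.re = p.2.re ∨ p.1.im = p.2.im) ∧ frontier Q'.carrier ⊆ ⋃ p ∈ S, segment ℝ p.1 p.2) → ∀ (ψ : Literature.Probability.RandomPlanarGeometry.ConformalEquiv UpperHalfPlane.upperHalfPlaneSet Q.carrier) (y : Fin 4 → ℝ) (ψ' : Literature.Probability.RandomPlanarGeometry.ConformalEquiv UpperHalfPlane.upperHalfPlaneSet Q'.carrier) (y' : Fin 4 → ℝ), Q.IsUniformizing ψ y → Q'.IsUniformizing ψ' y' → Literature.Probability.RandomPlanarGeometry.crossRatio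 y = Literature.Probability.RandomPlanarGeometry.crossRatio y' → Filter.Tendsto (fun δ : ℝ ↦ Literature.Probability.Percolation.bondDomainCrossingProb Q δ - Literature.Probability.Percolation.bondDomainCrossingProb Q' δ) (nhdsWithin (0 : ℝ) (Set.Ioi 0)) (nhds 0))) :
    CardyWhiteToColoured.SimilarityUpgrade :=
  similarityUpgrade_of_confInvTransport (confInvTransport_of_rectilinearInvariance h₁)

/-- **S1 ⇒ H3: the heart of crux stmt-0794's line implies the heart of crux stmt-4597's line**,
unconditionally (through `SimilarityUpgrade` and `rectilinearHeart_of_similarityUpgrade`). H3 is the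
`LimitExists`-conditional, hence weaker, form of S1. -/
theorem rectilinearHeart_of_rectilinearInvariance (h₁ : (∀ (Q Q' : Literature.Probability.RandomPlanarGeometry.ConformalRectangle), (∃ S : Finset (ℂ × ℂ), (∀ p ∈ S, p.1.re = p.2.re ∨ p.1.im = p.2.im) ∧ frontier Q.carrier ⊆ ⋃ p ∈ S, segment ℝ p.1 p.2) → (∃ S : Finset (ℂ × ℂ), (∀ p ∈ S, p.1.re = p.2.re ∨ p.1.im = p.2.im) ∧ frontier Q'.carrier ⊆ ⋃ p ∈ S, segment ℝ p.1 p.2) → ∀ (ψ : Literature.Probability.RandomPlanarGeometry.ConformalEquiv UpperHalfPlane.upperHalfPlaneSet Q.carrier) (y : Fin 4 → ℝ) (ψ' : Literature.Probability.RandomPlanarGeometry.ConformalEquiv UpperHalfPlane.upperHalfPlaneSet Q'.carrier) (y' : Fin 4 → ℝ), Q.IsUniformizing ψ y → Q'.IsUniformizing ψ' y' → Literature.Probability.RandomPlanarGeometry.crossRatio y = Literature.Probability.RandomPlanarGeometry.crossRatio y' → Filter.Tendsto (fun δ : ℝ ↦ Literature.Probability.Percolation.bondDomainCrossingProb Q δ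 - Literature.Probability.Percolation.bondDomainCrossingProb Q' δ) (nhdsWithin (0 : ℝ) (Set.Ioi 0)) (nhds 0))) :
    (∀ Φ : ConformalRectangle → ℝ,
      (∀ R : ConformalRectangle, Tendsto (bondDomainCrossingProb R) (𝓝[>] (0 : ℝ)) (𝓝 (Φ R))) →
      (∀ (R R' : ConformalRectangle) (a w : ℂ), a ≠ 0 →
        R'.carrier = (fun z : ℂ => a * z + w) '' R.carrier →
        R'.arc 0 = (fun z : ℂ => a * z + w) '' R.arc 0 →
        R'.arc 2 = (fun z : ℂ => a * z + w) '' R.arc 2 → Φ R' = Φ R) →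
      ∀ (R R' : ConformalRectangle),
        (∃ S : Finset (ℂ × ℂ), (∀ p ∈ S, p.1.re = p.2.re ∨ p.1.im = p.2.im) ∧
          frontier R.carrier ⊆ ⋃ p ∈ S, segment ℝ p.1 p.2) →
        (∃ w : ℝ, 0 < w ∧ R'.carrier = (Ioo (0 : ℝ) w ×ℂ Ioo (0 : ℝ) 1) ∧
          R'.arc 0 = {z : ℂ | z.re = 0 ∧ z.im ∈ Icc (0 : ℝ) 1} ∧
          R'.arc 2 = {z : ℂ | z.re = w ∧ z.im ∈ Icc (0 : ℝ) 1} ∧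
          R'.pt 0 = Complex.I ∧ R'.pt 1 = 0 ∧ R'.pt 2 = (w : ℂ) ∧ R'.pt 3 = (w : ℂ) + Complex.I) →
        ∀ (φ : ConformalEquiv UpperHalfPlane.upperHalfPlaneSet R.carrier) (x : Fin 4 → ℝ)
          (φ' : ConformalEquiv UpperHalfPlane.upperHalfPlaneSet R'.carrier) (x' : Fin 4 → ℝ),
          R.IsUniformizing φ x → R'.IsUniformizing φ' x' → crossRatio x = crossRatio x' →
          Φ R = Φ R') :=
  rectilinearHeart_of_similarityUpgrade (similarityUpgrade_of_rectilinearInvariance h₁)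

/-- **X_U ⇒ `ConfInvTransport`** (stmt-0745 ⇒ stmt-0794), unconditionally: if every conformal
rectangle has the limit `f (crossRatio ·)`, a limit `L` of `R` equals `f (crossRatio x)`
(uniqueness of limits along the non-trivial filter `𝓝[>] 0`), which is also the limit of `R'`. -/
theorem confInvTransport_of_thesis (hX : CardyUniqueLimitThesis) : ConfInvTransport := by
  intro R R' φ x φ' x' hx hx' hη L hL
  obtain ⟨f, hf⟩ := hX
  have h1 : L = f (crossRatio x) := tendsto_nhds_unique hL (hf R φ x hx)
  rw [h1, hη]
  exact hf R' φ' x' hx'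

/-- **X_U ⇒ S1** (stmt-0745 ⇒ the heart of stmt-0794), unconditionally: both crossing
probabilities tend to `f η`, so their difference tends to `0` (rectilinearity is not used). -/
theorem rectilinearInvariance_of_thesis (hX : CardyUniqueLimitThesis) : (∀ (Q Q' : Literature.Probability.RandomPlanarGeometry.ConformalRectangle), (∃ S : Finset (ℂ × ℂ), (∀ p ∈ S, p.1.re = p.2.re ∨ p.1.im = p.2.im) ∧ frontier Q.carrier ⊆ ⋃ p ∈ S, segment ℝ p.1 p.2) → (∃ S : Finset (ℂ × ℂ), (∀ p ∈ S, p.1.re = p.2.re ∨ p.1.im = p.2.im) ∧ frontier Q'.carrier ⊆ ⋃ p ∈ S, segment ℝ p.1 p.2) → ∀ (ψ : Literature.Probability.RandomPlanarGeometry.ConformalEquiv UpperHalfPlane.upperHalfPlaneSet Q.carrier) (y : Fin 4 → ℝ) (ψ' : Literature.Probability.RandomPlanarGeometry.ConformalEquiv UpperHalfPlane.upperHalfPlaneSet Q'.carrier) (y' : Fin 4 → ℝ), Q.IsUniformizing ψ y → Q'.IsUniformizing ψ' y' → Literature.Probability.RandomPlanarGeometry.crossRatio y = Literature.Probability.RandomPlanarGeometry.crossRatio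 y' → Filter.Tendsto (fun δ : ℝ ↦ Literature.Probability.Percolation.bondDomainCrossingProb Q δ - Literature.Probability.Percolation.bondDomainCrossingProb Q' δ) (nhdsWithin (0 : ℝ) (Set.Ioi 0)) (nhds 0)) := by
  intro Q Q' _ _ ψ y ψ' y' hy hy' hη
  obtain ⟨f, hf⟩ := hX
  have h1 := hf Q ψ y hy
  have h2 := hf Q' ψ' y' hy'
  rw [hη] at h1
  simpa using h1.sub h2

/-- **`LimitExists → ConfInvTransport → X_U`** (the logic of the glue `CardyUniqueLimit.LimitTransportGlue`,
stmt-14241): put `f η :=` the limit of SOME conformal rectangle carrying a uniformizing datum of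
cross-ratio `η` (junk `0` if there is none); for `R` with datum `(φ, x)` a witness of
`η = crossRatio x` exists, its crossing probabilities tend to `f η` by the choice of limits, and
`ConfInvTransport` carries this limit over to `R`. -/
theorem thesis_of_confInvTransport_of_limitExists (hL : LimitExists) (hT : ConfInvTransport) :
    CardyUniqueLimitThesis := by
  classical
  choose Lim hLim using hL
  refine ⟨fun η => if h : ∃ (S : ConformalRectangle)
      (ψ : ConformalEquiv UpperHalfPlane.upperHalfPlaneSet S.carrier) (y : Fin 4 → ℝ),
      S.IsUniformizing ψ y ∧ crossRatio y = η then Lim h.choose else 0, ?_⟩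
  intro R φ x hx
  have h : ∃ (S : ConformalRectangle) (ψ : ConformalEquiv UpperHalfPlane.upperHalfPlaneSet S.carrier)
      (y : Fin 4 → ℝ), S.IsUniformizing ψ y ∧ crossRatio y = crossRatio x := ⟨R, φ, x, hx, rfl⟩
  dsimp only
  rw [dif_pos h]
  obtain ⟨ψ, y, hy, hcr⟩ := h.choose_spec
  exact hT h.choose R ψ y φ x hy hx hcr (Lim h.choose) (hLim h.choose)

/-- **Under `LimitExists`, `ConfInvTransport ⇒ S1`**: the limit `L` of `Q` is transported to `Q'`,
so the difference of the crossing probabilities tends to `L - L = 0`. -/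
theorem rectilinearInvariance_of_confInvTransport_of_limitExists (hL : LimitExists)
    (hT : ConfInvTransport) : (∀ (Q Q' : Literature.Probability.RandomPlanarGeometry.ConformalRectangle), (∃ S : Finset (ℂ × ℂ), (∀ p ∈ S, p.1.re = p.2.re ∨ p.1.im = p.2.im) ∧ frontier Q.carrier ⊆ ⋃ p ∈ S, segment ℝ p.1 p.2) → (∃ S : Finset (ℂ × ℂ), (∀ p ∈ S, p.1.re = p.2.re ∨ p.1.im = p.2.im) ∧ frontier Q'.carrier ⊆ ⋃ p ∈ S, segment ℝ p.1 p.2) → ∀ (ψ : Literature.Probability.RandomPlanarGeometry.ConformalEquiv UpperHalfPlane.upperHalfPlaneSet Q.carrier) (y : Fin 4 → ℝ) (ψ' : Literature.Probability.RandomPlanarGeometry.ConformalEquiv UpperHalfPlane.upperHalfPlaneSet Q'.carrier) (y' : Fin 4 → ℝ), Q.IsUniformizing ψ y → Q'.IsUniformizing ψ' y' → Literature.Probability.RandomPlanarGeometry.crossRatio y = Literature.Probability.RandomPlanarGeometry.crossRatio y' → Filter.Tendsto (fun δ : ℝ ↦ Literature.Probability.Percolation.bondDomainCrossingProb Q δ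 - Literature.Probability.Percolation.bondDomainCrossingProb Q' δ) (nhdsWithin (0 : ℝ) (Set.Ioi 0)) (nhds 0)) := by
  intro Q Q' _ _ ψ y ψ' y' hy hy' hη
  obtain ⟨L, hQ⟩ := hL Q
  have hQ' := hT Q Q' ψ y ψ' y' hy hy' hη L hQ
  simpa using hQ.sub hQ'

/-- **Under `LimitExists`, X_U, `ConfInvTransport` and S1 are equivalent** (no DKKMO needed). -/
theorem thesis_tfae_of_limitExists (hL : LimitExists) :
    List.TFAE [CardyUniqueLimitThesis, ConfInvTransport, (∀ (Q Q' : Literature.Probability.RandomPlanarGeometry.ConformalRectangle), (∃ S : Finset (ℂ × ℂ), (∀ p ∈ S, p.1.re = p.2.re ∨ p.1.im = p.2.im) ∧ frontier Q.carrier ⊆ ⋃ p ∈ S, segment ℝ p.1 p.2) → (∃ S : Finset (ℂ × ℂ), (∀ p ∈ S, p.1.re = p.2.re ∨ p.1.im = p.2.im) ∧ frontier Q'.carrier ⊆ ⋃ p ∈ S, segment ℝ p.1 p.2) → ∀ (ψ : Literature.Probability.RandomPlanarGeometry.ConformalEquiv UpperHalfPlane.upperHalfPlaneSet Q.carrier)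 (y : Fin 4 → ℝ) (ψ' : Literature.Probability.RandomPlanarGeometry.ConformalEquiv UpperHalfPlane.upperHalfPlaneSet Q'.carrier) (y' : Fin 4 → ℝ), Q.IsUniformizing ψ y → Q'.IsUniformizing ψ' y' → Literature.Probability.RandomPlanarGeometry.crossRatio y = Literature.Probability.RandomPlanarGeometry.crossRatio y' → Filter.Tendsto (fun δ : ℝ ↦ Literature.Probability.Percolation.bondDomainCrossingProb Q δ - Literature.Probability.Percolation.bondDomainCrossingProb Q' δ) (nhdsWithin (0 : ℝ) (Set.Ioi 0)) (nhds 0))] := by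
  tfae_have 1 → 2 := confInvTransport_of_thesis
  tfae_have 2 → 3 := rectilinearInvariance_of_confInvTransport_of_limitExists hL
  tfae_have 3 → 1 := fun h₁ =>
    thesis_of_confInvTransport_of_limitExists hL (confInvTransport_of_rectilinearInvariance h₁)
  tfae_finish

/-! ### Modulo DKKMO Cor. 1.3: the two hearts are equivalent under `LimitExists` -/

/-- **Modulo DKKMO Cor. 1.3 and `LimitExists`, H3 ⇒ X_U**: H3 ⇒ `SimilarityUpgrade`
(`similarityUpgrade_of_rectilinearHeart`, c2) and `SimilarityUpgrade ⇒ (LimitExists → X_U)`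
(`similarityUpgrade_iff_limitExists_imp_thesis`, c3; DKKMO supplies the similarity invariance of the
chosen full limit). [cite: DKKMO2020Rotational, Cor. 1.3 (q = 1)] -/
theorem thesis_of_rectilinearHeart_of_limitExists (hdk : dkkmo_crossing_rotation_invariance)
    (hL : LimitExists) (hH3 : (∀ Φ : ConformalRectangle → ℝ,
      (∀ R : ConformalRectangle, Tendsto (bondDomainCrossingProb R) (𝓝[>] (0 : ℝ)) (𝓝 (Φ R))) →
      (∀ (R R' : ConformalRectangle) (a w : ℂ), a ≠ 0 →
        R'.carrier = (fun z : ℂ => a * z + w) '' R.carrier →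
        R'.arc 0 = (fun z : ℂ => a * z + w) '' R.arc 0 →
        R'.arc 2 = (fun z : ℂ => a * z + w) '' R.arc 2 → Φ R' = Φ R) →
      ∀ (R R' : ConformalRectangle),
        (∃ S : Finset (ℂ × ℂ), (∀ p ∈ S, p.1.re = p.2.re ∨ p.1.im = p.2.im) ∧
          frontier R.carrier ⊆ ⋃ p ∈ S, segment ℝ p.1 p.2) →
        (∃ w : ℝ, 0 < w ∧ R'.carrier = (Ioo (0 : ℝ) w ×ℂ Ioo (0 : ℝ) 1) ∧
          R'.arc 0 = {z : ℂ | z.re = 0 ∧ z.im ∈ Icc (0 : ℝ) 1} ∧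
          R'.arc 2 = {z : ℂ | z.re = w ∧ z.im ∈ Icc (0 : ℝ) 1} ∧
          R'.pt 0 = Complex.I ∧ R'.pt 1 = 0 ∧ R'.pt 2 = (w : ℂ) ∧ R'.pt 3 = (w : ℂ) + Complex.I) →
        ∀ (φ : ConformalEquiv UpperHalfPlane.upperHalfPlaneSet R.carrier) (x : Fin 4 → ℝ)
          (φ' : ConformalEquiv UpperHalfPlane.upperHalfPlaneSet R'.carrier) (x' : Fin 4 → ℝ),
          R.IsUniformizing φ x → R'.IsUniformizing φ' x' → crossRatio x = crossRatio x' →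
          Φ R = Φ R')) : CardyUniqueLimitThesis :=
  (similarityUpgrade_iff_limitExists_imp_thesis hdk).1 (similarityUpgrade_of_rectilinearHeart hH3) hL

/-- **Modulo DKKMO Cor. 1.3 and `LimitExists`, H3 ⇒ S1**: the heart of stmt-4597's line gives back
the heart of stmt-0794's line once all crossing limits exist. With
`rectilinearHeart_of_rectilinearInvariance` (S1 ⇒ H3, unconditional) the two registered hearts are
then EQUIVALENT. [cite: DKKMO2020Rotational, Cor. 1.3 (q = 1)] -/
theorem rectilinearInvariance_of_rectilinearHeart (hdk : dkkmo_crossing_rotation_invariance)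
    (hL : LimitExists) (hH3 : (∀ Φ : ConformalRectangle → ℝ,
      (∀ R : ConformalRectangle, Tendsto (bondDomainCrossingProb R) (𝓝[>] (0 : ℝ)) (𝓝 (Φ R))) →
      (∀ (R R' : ConformalRectangle) (a w : ℂ), a ≠ 0 →
        R'.carrier = (fun z : ℂ => a * z + w) '' R.carrier →
        R'.arc 0 = (fun z : ℂ => a * z + w) '' R.arc 0 →
        R'.arc 2 = (fun z : ℂ => a * z + w) '' R.arc 2 → Φ R' = Φ R) →
      ∀ (R R' : ConformalRectangle),
        (∃ S : Finset (ℂ × ℂ), (∀ p ∈ S, p.1.re = p.2.re ∨ p.1.im = p.2.im) ∧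
          frontier R.carrier ⊆ ⋃ p ∈ S, segment ℝ p.1 p.2) →
        (∃ w : ℝ, 0 < w ∧ R'.carrier = (Ioo (0 : ℝ) w ×ℂ Ioo (0 : ℝ) 1) ∧
          R'.arc 0 = {z : ℂ | z.re = 0 ∧ z.im ∈ Icc (0 : ℝ) 1} ∧
          R'.arc 2 = {z : ℂ | z.re = w ∧ z.im ∈ Icc (0 : ℝ) 1} ∧
          R'.pt 0 = Complex.I ∧ R'.pt 1 = 0 ∧ R'.pt 2 = (w : ℂ) ∧ R'.pt 3 = (w : ℂ) + Complex.I) →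
        ∀ (φ : ConformalEquiv UpperHalfPlane.upperHalfPlaneSet R.carrier) (x : Fin 4 → ℝ)
          (φ' : ConformalEquiv UpperHalfPlane.upperHalfPlaneSet R'.carrier) (x' : Fin 4 → ℝ),
          R.IsUniformizing φ x → R'.IsUniformizing φ' x' → crossRatio x = crossRatio x' →
          Φ R = Φ R')) : (∀ (Q Q' : Literature.Probability.RandomPlanarGeometry.ConformalRectangle), (∃ S : Finset (ℂ × ℂ), (∀ p ∈ S, p.1.re = p.2.re ∨ p.1.im = p.2.im) ∧ frontier Q.carrier ⊆ ⋃ p ∈ S, segment ℝ p.1 p.2) → (∃ S : Finset (ℂ × ℂ), (∀ p ∈ S, p.1.re = p.2.re ∨ p.1.im = p.2.im) ∧ frontier Q'.carrier ⊆ ⋃ p ∈ S, segment ℝ p.1 p.2) → ∀ (ψ : Literature.Probability.RandomPlanarGeometry.ConformalEquiv UpperHalfPlane.upperHalfPlaneSet Q.carrier) (y : Fin 4 → ℝ) (ψ' : Literature.Probability.RandomPlanarGeometry.ConformalEquiv UpperHalfPlane.upperHalfPlaneSet Q'.carrier) (y' : Fin 4 → ℝ), Q.IsUniformizing ψ y →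 Q'.IsUniformizing ψ' y' → Literature.Probability.RandomPlanarGeometry.crossRatio y = Literature.Probability.RandomPlanarGeometry.crossRatio y' → Filter.Tendsto (fun δ : ℝ ↦ Literature.Probability.Percolation.bondDomainCrossingProb Q δ - Literature.Probability.Percolation.bondDomainCrossingProb Q' δ) (nhdsWithin (0 : ℝ) (Set.Ioi 0)) (nhds 0)) :=
  rectilinearInvariance_of_thesis (thesis_of_rectilinearHeart_of_limitExists hdk hL hH3)

/-- **Modulo DKKMO Cor. 1.3, under `LimitExists` the five statements coincide**:
`SimilarityUpgrade` (stmt-4597) ⇔ X_U (stmt-0745) ⇔ `ConfInvTransport` (stmt-0794) ⇔ S1 (heart of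
0794's line) ⇔ H3 (heart of 4597's line). Only the step `SimilarityUpgrade ⇒ X_U` uses DKKMO (the
similarity invariance of the chosen full limit); every other arrow is unconditional or uses
`LimitExists` alone. [cite: DKKMO2020Rotational, Cor. 1.3 (q = 1)] -/
theorem hearts_tfae_of_limitExists (hdk : dkkmo_crossing_rotation_invariance) (hL : LimitExists) :
    List.TFAE [CardyWhiteToColoured.SimilarityUpgrade, CardyUniqueLimitThesis, ConfInvTransport,
      (∀ (Q Q' : Literature.Probability.RandomPlanarGeometry.ConformalRectangle), (∃ S : Finset (ℂ × ℂ), (∀ p ∈ S, p.1.re = p.2.re ∨ p.1.im = p.2.im) ∧ frontier Q.carrier ⊆ ⋃ p ∈ S, segment ℝ p.1 p.2) → (∃ S : Finset (ℂ × ℂ), (∀ p ∈ S, p.1.re = p.2.re ∨ p.1.im = p.2.im) ∧ frontier Q'.carrier ⊆ ⋃ p ∈ S, segment ℝ p.1 p.2) → ∀ (ψ : Literature.Probability.RandomPlanarGeometry.ConformalEquiv UpperHalfPlane.upperHalfPlaneSet Q.carrier) (y : Fin 4 → ℝ) (ψ' : Literature.Probability.RandomPlanarGeometry.ConformalEquiv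 UpperHalfPlane.upperHalfPlaneSet Q'.carrier) (y' : Fin 4 → ℝ), Q.IsUniformizing ψ y → Q'.IsUniformizing ψ' y' → Literature.Probability.RandomPlanarGeometry.crossRatio y = Literature.Probability.RandomPlanarGeometry.crossRatio y' → Filter.Tendsto (fun δ : ℝ ↦ Literature.Probability.Percolation.bondDomainCrossingProb Q δ - Literature.Probability.Percolation.bondDomainCrossingProb Q' δ) (nhdsWithin (0 : ℝ) (Set.Ioi 0)) (nhds 0)), (∀ Φ : ConformalRectangle → ℝ,
      (∀ R : ConformalRectangle, Tendsto (bondDomainCrossingProb R) (𝓝[>] (0 : ℝ)) (𝓝 (Φ R))) →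
      (∀ (R R' : ConformalRectangle) (a w : ℂ), a ≠ 0 →
        R'.carrier = (fun z : ℂ => a * z + w) '' R.carrier →
        R'.arc 0 = (fun z : ℂ => a * z + w) '' R.arc 0 →
        R'.arc 2 = (fun z : ℂ => a * z + w) '' R.arc 2 → Φ R' = Φ R) →
      ∀ (R R' : ConformalRectangle),
        (∃ S : Finset (ℂ × ℂ), (∀ p ∈ S, p.1.re = p.2.re ∨ p.1.im = p.2.im) ∧
          frontier R.carrier ⊆ ⋃ p ∈ S, segment ℝ p.1 p.2) →
        (∃ w : ℝ, 0 < w ∧ R'.carrier = (Ioo (0 : ℝ) w ×ℂ Ioo (0 : ℝ) 1) ∧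
          R'.arc 0 = {z : ℂ | z.re = 0 ∧ z.im ∈ Icc (0 : ℝ) 1} ∧
          R'.arc 2 = {z : ℂ | z.re = w ∧ z.im ∈ Icc (0 : ℝ) 1} ∧
          R'.pt 0 = Complex.I ∧ R'.pt 1 = 0 ∧ R'.pt 2 = (w : ℂ) ∧ R'.pt 3 = (w : ℂ) + Complex.I) →
        ∀ (φ : ConformalEquiv UpperHalfPlane.upperHalfPlaneSet R.carrier) (x : Fin 4 → ℝ)
          (φ' : ConformalEquiv UpperHalfPlane.upperHalfPlaneSet R'.carrier) (x' : Fin 4 → ℝ),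
          R.IsUniformizing φ x → R'.IsUniformizing φ' x' → crossRatio x = crossRatio x' →
          Φ R = Φ R')] := by
  tfae_have 1 → 2 := fun h => (similarityUpgrade_iff_limitExists_imp_thesis hdk).1 h hL
  tfae_have 2 → 3 := confInvTransport_of_thesis
  tfae_have 3 → 4 := rectilinearInvariance_of_confInvTransport_of_limitExists hL
  tfae_have 4 → 5 := rectilinearHeart_of_rectilinearInvariance
  tfae_have 5 → 1 := similarityUpgrade_of_rectilinearHeart
  tfae_finish

/-! ### Registered form (c5 goal of crux stmt-CriticalPhenomena-4597) -/

/-- **Registered c5 goal `stub_heartsCoincide` (line `registered`, lead c5): S1 ⇒ H3** — the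
registered heart of crux stmt-0794's line `birth` (limit-free asymptotic equality of the bond-ℤ²
crossing probabilities of rectilinear conformal rectangles of equal modulus) implies the registered
heart of crux stmt-4597's line `registered` (a full similarity-invariant limit takes the same value
on a rectilinear quad and on the corner box of equal modulus), unconditionally
(`rectilinearHeart_of_rectilinearInvariance`). -/
theorem stub_heartsCoincide : (∀ (Q Q' : ConformalRectangle), (∃ S : Finset (ℂ × ℂ), (∀ p ∈ S, p.1.re = p.2.re ∨ p.1.im = p.2.im) ∧ frontier Q.carrier ⊆ ⋃ p ∈ S, segment ℝ p.1 p.2) → (∃ S : Finset (ℂ × ℂ), (∀ p ∈ S, p.1.re = p.2.re ∨ p.1.im = p.2.im) ∧ frontier Q'.carrier ⊆ ⋃ p ∈ S, segment ℝ p.1 p.2) → ∀ (ψ : ConformalEquiv UpperHalfPlane.upperHalfPlaneSet Q.carrier) (y : Fin 4 → ℝ) (ψ' : ConformalEquiv UpperHalfPlane.upperHalfPlaneSet Q'.carrier) (y' : Fin 4 → ℝ), Q.IsUniformizing ψ y → Q'.IsUniformizing ψ' y' → crossRatio y = crossRatio y' → Tendsto (fun δ : ℝ => bondDomainCrossingProb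 Q δ - bondDomainCrossingProb Q' δ) (𝓝[>] (0 : ℝ)) (𝓝 0)) → ∀ Φ : ConformalRectangle → ℝ, (∀ R : ConformalRectangle, Tendsto (bondDomainCrossingProb R) (𝓝[>] (0 : ℝ)) (𝓝 (Φ R))) → (∀ (R R' : ConformalRectangle) (a w : ℂ), a ≠ 0 → R'.carrier = (fun z : ℂ => a * z + w) '' R.carrier → R'.arc 0 = (fun z : ℂ => a * z + w) '' R.arc 0 → R'.arc 2 = (fun z : ℂ => a * z + w) '' R.arc 2 → Φ R' = Φ R) → ∀ (R R' : ConformalRectangle), (∃ S : Finset (ℂ × ℂ), (∀ p ∈ S, p.1.re = p.2.re ∨ p.1.im = p.2.im) ∧ frontier R.carrier ⊆ ⋃ p ∈ S, segment ℝ p.1 p.2) → (∃ w : ℝ, 0 < w ∧ R'.carrier = (Ioo (0 : ℝ) w ×ℂ Ioo (0 : ℝ) 1) ∧ R'.arc 0 = {z : ℂ | z.re = 0 ∧ z.im ∈ Icc (0 : ℝ) 1} ∧ R'.arc 2 = {z : ℂ | z.re = w ∧ z.im ∈ Icc (0 : ℝ) 1} ∧ R'.pt 0 = Complex.I ∧ R'.pt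 1 = 0 ∧ R'.pt 2 = (w : ℂ) ∧ R'.pt 3 = (w : ℂ) + Complex.I) → ∀ (φ : ConformalEquiv UpperHalfPlane.upperHalfPlaneSet R.carrier) (x : Fin 4 → ℝ) (φ' : ConformalEquiv UpperHalfPlane.upperHalfPlaneSet R'.carrier) (x' : Fin 4 → ℝ), R.IsUniformizing φ x → R'.IsUniformizing φ' x' → crossRatio x = crossRatio x' → Φ R = Φ R' :=
  rectilinearHeart_of_rectilinearInvariance

end Summit.CriticalPhenomena.CardyFormulaZ2.Theorems.SimilarityUpgradeReduction

end
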